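import Summits.QuantumFields.YangMills.Theorems.BalabanUVNodesN18AtByName
import Summits.QuantumFields.YangMills.Theorems.BalabanUVNodesN18KingModelU3
import Literature.MathematicalPhysics.QuantumFieldTheory.Balaban1983to89.T4TowerRateComposition

/-!
# BalabanUVNodes ∕ N18 — THE KING-MODEL U3 RUNG: node U3's whole rate content (`N18At` = NE5, `N22At` = NE9 ∧ fading
# memory, the argument bracket (T) `LipBackground`∕`PolyLipGrowth`, and the composed node-U3 target) DECIDED in King's
# `A = 0` model for King's ACTUAL (4.42) three-factor graphs on Bałaban's tori, with `κ > 0`, `θ = L^{−γ∕2} < 1`; the same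
# model placed on the END's own carriers `torusCarriers`∕`reFunctional` (`TwoRunTorusNE5Final8`); and the one-line statement,
# as theorems, of what Bałaban's `V`-dependence adds (Track A, DAG node N18 = NE5; FAN-OUT v1.1 §N18 s3)

HONEST FRAMING.  Count-neutral kernel bookkeeping (seat pub-ymgap-dag-n18-e g0, strategy s3 «alternative currency»;
`--supports stmt-QuantumFields-19676` = K3 `SpineGivenEndpointR11`).  King's `A = 0` scalar MODEL ([King1986], template
literature, printed and proved, typed by seats n18-a∕n18-b) — NOT Bałaban's covariant one-step outputs `E^{(j)}(X; g, U_k(V))`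
of [Balaban1987RG1] (0.24)∕(2.13), for which NE5 is NOT IN PRINT and has no tree producer (NODE O instance 0∕1); NOT a node
discharge; finite tori; nothing continuum ∕ ℝ⁴ ∕ OS ∕ mass-gap ∕ Clay.  THEOREMS ONLY: 0 `def`, 0 `sorry`, standard axioms.

THE POINT («NE5 in King's model», packaged at the rung where the route consumes it).  Since module 2 of the route package
(`BalabanUVNodesSpineRates`, p418381) node U3's rates live on ONE shared bundle `u : U3Carriers = ⟨C, W, γ, κ, EA, EB, θ, C₅,
Λ, C₉, ω, cr, ρ⟩` and are consumed by the N19 rate edge (`N19RateEdgeByName.rateEdge_of_linkReading_byName`) as `N18At u`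
(NE5 at every member of run B's first-coupling family), `N22At u` (NE9 with history moduli `Λ` ∧ `FadingMemory C₉ ω Λ`) and the
bracket (T) `LipBackground u.EA u.W u.κ CU ∧ PolyLipGrowth CU …` ([Balaban1988Convergent] (2.27)(ii)–(2.28)); the three meet
in `T4OutputRate.u3_threeBrackets`∕`u3_geometric` (argument bracket `a`, coupling bracket `b`, functional bracket `C₅`).
The n18-a lineage decided `N18At` in the model (`N18AtByName.n18At_kingModel_threeFactor_torus`) and the composed target
for the sup-norm reading (`N18KingModelU3.u3Target_of_kingModel`, `κ = 0`).  THIS FILE closes the rung: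
* §1 ZERO LETTERS — `lipBackground_zero_iff_unreadOn`: the bracket (T) holds with the ZERO constant family iff run A
  does not read the background on the window (the `CU`-side twin of `N18Coherence.lipBackground_iff_of_gauge_zero`, valid
  on carriers with a genuine gauge); `ne9_zero_iff_couplingBlindOn`: NE9 with zero moduli iff coupling-blind on the window;
  `polyLipGrowth_zero`; `n22At_of_couplingBlind`; and the ONE-LINE STATEMENT OF WHAT `V`-DEPENDENCE ADDS as a theorem:
  `backgroundDefect_le_of_u3TargetAll` ∕ `not_u3TargetAll_of_backgroundDefect` — node U3's target asked at ALL pairs of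
  backgrounds (as the model delivers it) bounds run A's OWN background dependence by twice the target, so for a
  `V`-READING `E^{(j)}(X; g, U_k(V))` the target can hold only ALONG THE `V`-DRIVEN PAIRS `(U^A_K(V), U^B_{K+1}(V))`, and
  its price there is rows NE3∕U1b × the (2.27)(ii) Cauchy–Lipschitz family: `T4RateLiaison.u3_of_localRate`,
  `T4TowerRateComposition.argBracket_tower` (cited BY NAME, not restated).
* §2 **`u3Rung_kingModel_threeFactor_torus`** — for `d ≥ 1`, odd `L > 1`, `a > 0`, `m² > 0`, `0 ≤ γ ≤ 1` there are
  `κ > 0`, `C₅ ≥ 0` (functions of `d, L, a, m², γ` ONLY — `N18KingModelTorus.ne5_kingModel_threeFactor_torus`, p418046)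
  such that for every reading of King's ACTUAL (4.42) three-factor graphs on Bałaban's tori (every `n ≥ 1`, every
  scale-indexed family of unit tori `L·M_j(μ) = 2L^{m_j}`, every carriers with fine points of run A under run B's and
  `d X ≤ |B(x_A) − B(y_A)|_{T₁}`), every window `W`, radius `γ′` and read-out letters `ω, cr, ρ`, the bundle
  `u = ⟨C, W, γ′, κ, EA, fun _ => EB, L^{−γ∕2}, C₅, 0, 0, ω, cr, ρ⟩` carries ALL of: `N18At u` · `N22At u` ·
  `LipBackground EA W κ 0` · `PolyLipGrowth 0 gA 0 q` (every table, every degree) · node U3's composed target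
  `|EA gA UA X − EB gB UB X| ≤ (0 + 0 + C₅)·(L^{−γ∕2})^{scale X}·e^{−κ·dX}` at ANY two admissible coupling sequences and ANY
  two backgrounds — `u3_geometric` with `a = b = 0`.  The rung's letters have content: `κ > 0`; `0 < L^{−γ∕2} < 1` iff
  `γ > 0` (`N18KingModelTorus.ne5_kingModel_threeFactor_letters`); the binders are jointly satisfiable with a non-idle
  tree length (`N18KingModelTorus.ne5_kingModel_threeFactor_inhabited`).  N17∕(D4) are NOT modelled: King has no running
  coupling, and a coupling-blind functional represents only constant β-functions (`N18Coherence.representsA_const_of_couplingBlind`).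
  `u3Rung_kingModel_prop38`: the same four-plus-target package for the SUP-NORM reading (Prop. 3.8 (3.71) line 1,
  `N18KingModel.ne5_of_kingModel`, ANY carriers with `scale ≥ 1`): `θ = L^{−γ}`, decay exponent `0`.
* §3 AT THE END's CARRIERS (director-ym R134 row «King-model transfer → `TwoRunTorusNE5Final*`»).  The END of row NE5
  (`TwoRunTorusNE5Final8.ne5_end_final_all8`) concludes `NE5` on `TwoRunTorusNE5.torusCarriers N W` through the read-out
  `reFunctional N W`, and `N18AtByName.n18At_of_end8_shape` reads `N18At` on exactly that bundle shape.
  `ne5_reFunctional_of_real`: ANY two real families on the torus domains with `|K_A − K_B| ≤ C₅θ^j e^{−κ′d_j(X)}` give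
  `NE5 (torusCarriers N W) (reFunctional … K_A) (reFunctional … K_B) W′ κ′ θ C₅`; `ne5_kingModel_endCarriers` ∕
  `n18At_kingModel_endCarriers`: King's Prop-3.8 kernels `ℋ_{j+1}` (run A) and `ℋ_{j+1+n}` (run B) read from the END's
  domains (King's levels start at 1, (2.13); the END's creation scales at 0) inhabit that shape with `θ = L^{−γ} < 1`
  (`γ > 0`), ONE constant, EVERY torus family `W j : TwoTorusStep 4 L′ (N j)`, and `κ′ = 0`.  LOCATED: `κ′ = 0` is
  forced — King's graphs are indexed by POINTS and carry no decay in Bałaban's tree length `d_j(X) ≥ (|X|∕2⁴ − 1)∕4`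
  (`TreeLengthTorus.card_le_torusTreeLen`) of many-cube domains; that decay is (0.25)∕(2.41) = NODE A ∕ N10 content.
  The letters have content: `0 < L^{−γ} < 1` iff `γ > 0` (`N18KingModel.kingTheta_pos`∕`kingTheta_lt_one`).
WHAT BAŁABAN's `V`-DEPENDENCE ADDS, in one line: `a ≠ 0` (run A reads `U_k(V)`: (T) × NE3, §1), `b ≠ 0` (run A reads
`g₀, …, g_{j−1}`: N22 × node U2), and `κ′ > 0` in `d_j(X)` (cluster expansion) — the three inputs King's model discharges
VACUOUSLY are exactly nodes N16∕N22∕N17's and NODE A's load.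

Sources: C. King, *The U(1) Higgs model. I. The continuum limit*, Commun. Math. Phys. **102** (1986) 649–677 [King1986] —
Prop. 3.8 (3.71) p. 664, Prop. 3.9 (3.73) p. 665, (4.42)–(4.43) p. 675, p. 665 (*"the error is the same graph with a
difference of propagators on one line … Proposition 3.8 gives the desired factor L^{−γk}"*); T. Bałaban, Commun. Math. Phys.
**109** (1987) 249–301 [Balaban1987RG1] — §0 p. 256, (0.24)–(0.25) p. 257, Thm 1 p. 259 (uniformity in ε, the only printed
trace of NE5), §1 p. 263, §5 p. 298; **119** (1988) 243–285 [Balaban1988Convergent] (2.27)–(2.28) p. 259; **116** (1988) 1–22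
[Balaban1988RG2Cluster] (2.41) p. 21.  Nothing here is a claim about the Yang–Mills mass gap.
-/

noncomputable section

namespace Summit.QuantumFields.YangMills.BalabanUVNodes.N18KingModelU3Rung

open Matrix
open Literature.MathematicalPhysics.QuantumFieldTheory.Balaban1983to89
open Literature.MathematicalPhysics.QuantumFieldTheory.Balaban1983to89.T4OutputRate
  (Carriers Functional NE5 NE9 FadingMemory LipBackground)
open Literature.MathematicalPhysics.QuantumFieldTheory.Balaban1983to89.T4TowerRateComposition (PolyLipGrowth)
open Literature.MathematicalPhysics.QuantumFieldTheory.Balaban1983to89.B5Prop11Plancherel (Tor fine)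
open Literature.MathematicalPhysics.QuantumFieldTheory.Balaban1983to89.TreeLengthTorus (TDom tsys)
open Literature.MathematicalPhysics.QuantumFieldTheory.Balaban1983to89.B13Lemma3Torus (TwoTorusStep)
open Literature.MathematicalPhysics.QuantumFieldTheory.King1986 (aK prop38RateConst prop38PosConst)
open Literature.MathematicalPhysics.QuantumFieldTheory.King1986.Torus (minimiser effLaplacian blockProj blockOf tdistT)
open Summit.QuantumFields.BalabanUV.T4Continuum.Spine.NE5.TwoRunTorusNE5 (torusCarriers reFunctional)
open Summit.QuantumFields.YangMills.BalabanUVNodes.N18Coherence (ne9_zero_of_couplingBlind fadingMemory_zero)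
open Summit.QuantumFields.YangMills.BalabanUVNodes.N18KingModel
  (ne5_of_kingModel prop38Const_unif_nonneg kingTheta_pos kingTheta_le_one kingTheta_lt_one u3Target_of_unread)
open Summit.QuantumFields.YangMills.BalabanUVNodes.N18KingModelTorus (ne5_kingModel_threeFactor_torus)
open Summit.QuantumFields.YangMills.BalabanUVNodes.N18AtByName (n18At_of_ne5)
open YMDAG.UVSplit (U3Carriers N18At N22At)

/-! ## §1 Zero letters, and the one-line statement of what `V`-dependence adds -/

/-- **The bracket (T) with the ZERO constant family is background-blindness on the window.**  On ANY carriers (genuine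
gauge allowed), `LipBackground EA W κ (fun _ _ => 0)` holds iff run A's functional does not read the background at
admissible couplings.  (`N18Coherence.lipBackground_iff_of_gauge_zero` is the gauge-zero twin.)
[cite: Balaban1988Convergent, (2.27)-(2.28) p.259] -/
theorem lipBackground_zero_iff_unreadOn {C : Carriers} {EA : Functional C C.BgA} {W : Set (ℕ → ℝ)} {κ : ℝ} :
    LipBackground EA W κ (fun _ _ => 0) ↔ ∀ g ∈ W, ∀ (U U' : C.BgA) (X : C.Dom), EA g U X = EA g U' X := by
  constructor
  · intro h g hg U U' X
    have h0 := h g hg U U' X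
    rw [zero_mul, zero_mul] at h0
    exact sub_eq_zero.mp (abs_nonpos_iff.mp h0)
  · intro h g hg U U' X
    rw [h g hg U U' X, sub_self, abs_zero, zero_mul, zero_mul]

/-- **NE9 with the ZERO history moduli is coupling-blindness on the window.** [cite: Balaban1987RG1, §0 p.256 and §5 p.298] -/
theorem ne9_zero_iff_couplingBlindOn {C : Carriers} {Bg : Type} {E : Functional C Bg} {W : Set (ℕ → ℝ)} {κ : ℝ} :
    NE9 E W κ (fun _ _ => 0) ↔ ∀ g ∈ W, ∀ g' ∈ W, ∀ (U : Bg) (X : C.Dom), E g U X = E g' U X := by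
  constructor
  · intro h g hg g' hg' U X
    have h0 := h g hg g' hg' U X
    simp only [zero_mul, Finset.sum_const_zero, mul_zero] at h0
    exact sub_eq_zero.mp (abs_nonpos_iff.mp h0)
  · intro h g hg g' hg' U X
    rw [h g hg g' hg' U X, sub_self, abs_zero]
    simp

/-- The zero constant family has polynomial growth of degree `q` with constant `0`, along every table of coupling
sequences (the N19 edge's growth letter for (T)). [cite: Balaban1988Convergent, (2.27)-(2.28) p.259] -/
theorem polyLipGrowth_zero (gA : ℕ → ℕ → ℝ) (q : ℕ) : PolyLipGrowth (fun _ _ => 0) gA 0 q :=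
  fun _ _ _ => ⟨le_rfl, by rw [zero_mul]⟩

/-- **`N22At` for a coupling-blind run A**: NE9 with zero moduli and fading memory with `C₉ = 0`, at any window, radius,
rate letters and fading letter `ω` (`N18Coherence.ne9_zero_of_couplingBlind`, `fadingMemory_zero`).
[cite: Balaban1987RG1, §0 p.256 and §5 p.298] -/
theorem n22At_of_couplingBlind {C : Carriers} {EA : Functional C C.BgA} (hg : ∀ (g g' : ℕ → ℝ) (U : C.BgA) (X : C.Dom),
    EA g U X = EA g' U X) (W : Set (ℕ → ℝ)) (γ κ : ℝ) (EB : ℝ → Functional C C.BgB) (θ C₅ ω cr ρ : ℝ) :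
    N22At ⟨C, W, γ, κ, EA, EB, θ, C₅, fun _ _ => 0, 0, ω, cr, ρ⟩ :=
  ⟨ne9_zero_of_couplingBlind hg W κ, fadingMemory_zero ω⟩

/-- **WHAT `V`-DEPENDENCE ADDS, AS A THEOREM.**  If node U3's target holds at a domain `X` for ALL run-A backgrounds
against one run-B background, `|EA gA UA X − EB gB UB X| ≤ B` for every `UA`, then run A's OWN background dependence at
`X` is at most `2B`: `|EA gA UA X − EA gA UA′ X| ≤ 2B`.  So the all-pairs form of the target — the form King's `A = 0`
model delivers (§2, `N18KingModelU3.u3Target_of_kingModel`) — is available ONLY for functionals that are background-blind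
at rate; Bałaban's `E^{(j)}(X; g, U_k(V))` READS `V`, hence its target lives on the `V`-driven pairs and is priced by
NE3 × (2.27)(ii) (`T4RateLiaison.u3_of_localRate`). [cite: Balaban1987RG1, §1 p.263; Balaban1988Convergent, (2.27) p.259] -/
theorem backgroundDefect_le_of_u3TargetAll {C : Carriers} {EA : Functional C C.BgA} {EB : Functional C C.BgB}
    {gA gB : ℕ → ℝ} {X : C.Dom} {B : ℝ} (UB : C.BgB) (h : ∀ UA : C.BgA, |EA gA UA X - EB gB UB X| ≤ B)
    (UA UA' : C.BgA) : |EA gA UA X - EA gA UA' X| ≤ 2 * B := by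
  have h1 := h UA
  have h2 := h UA'
  rw [abs_sub_comm] at h2
  calc |EA gA UA X - EA gA UA' X| ≤ |EA gA UA X - EB gB UB X| + |EB gB UB X - EA gA UA' X| := abs_sub_le _ _ _
    _ ≤ 2 * B := by linarith

/-- Contrapositive: a run-A functional whose background dependence at `X` exceeds `2B` somewhere admits NO run-B partner
with the all-backgrounds target `≤ B` at `X`. [cite: Balaban1987RG1, §1 p.263] -/
theorem not_u3TargetAll_of_backgroundDefect {C : Carriers} {EA : Functional C C.BgA} (EB : Functional C C.BgB)
    {gA : ℕ → ℝ} (gB : ℕ → ℝ) {X : C.Dom} {B : ℝ} {UA UA' : C.BgA} (hdef : 2 * B < |EA gA UA X - EA gA UA' X|)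
    (UB : C.BgB) : ¬ ∀ UA : C.BgA, |EA gA UA X - EB gB UB X| ≤ B :=
  fun h => (not_le.2 hdef) (backgroundDefect_le_of_u3TargetAll UB h UA UA')

/-! ## §2 The U3 rung in King's model: the (4.42) three-factor graphs on Bałaban's tori -/

variable {d : ℕ}

/-- **THE KING-MODEL U3 RUNG** («NE5 in King's model» at node U3's shared bundle).  For `d ≥ 1`, odd `L > 1`, `a > 0`,
`m² > 0`, `0 ≤ γ ≤ 1` there are `κ > 0`, `C₅ ≥ 0` (functions of `d, L, a, m², γ` only) such that: for every `n ≥ 1`,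
every scale-indexed family of Bałaban unit tori `L·M_j(μ) = 2L^{m_j}`, every carriers `C` with `1 ≤ scale X` whose
domains read fine points `x_A, y_A` (run A, `L^j` per unit side) under `x_B, y_B` (run B, `L^nL^j`) with tree length
`d X ≤ |B(x_A) − B(y_A)|_{T₁}`, every pair of functionals reading King's ACTUAL (4.42) three-factor graphs (`ℋ_j C^{(j)} ℋ_j`
of run A at `(x_A, y_A)`, `ℋ_{j+n} C^{(j+n)} ℋ_{j+n}` of run B at `(x_B, y_B)`; `ℋ = minimiser`, `C^{(·)} = (effLaplacian +
aL⁻²·blockProj)⁻¹`), every window `W`, radius `γ′` and read-out letters `ω, cr, ρ`, with `θ = L^{−γ∕2}`: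
(i) `N18At ⟨C, W, γ′, κ, EA, fun _ => EB, θ, C₅, 0, 0, ω, cr, ρ⟩`; (ii) `N22At` of the same bundle; (iii) the bracket (T)
`LipBackground EA W κ 0`; (iv) `PolyLipGrowth 0 gA 0 q` for every table and degree; (v) node U3's composed target at ANY
`gA, gB ∈ W` and ANY backgrounds `UA, UB`: `|EA gA UA X − EB gB UB X| ≤ (0 + 0 + C₅)·θ^{scale X}·e^{−κ·d X}`.
Composition: `N18KingModelTorus.ne5_kingModel_threeFactor_torus` (Prop. 3.9 (3.73) first bound, j ≥ 1) with
`N18AtByName.n18At_of_ne5`, §1, and `N18KingModelU3.u3Target_of_unread` (`u3_geometric`, `a = b = 0`).  A = 0 MODEL;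
`g`∕`U` unread; `j = 0`, (2.20)-rescaling, derivative∕Hölder lines outside (`…TorusDeriv`∕`…TorusHolder*`).
[cite: King1986, Prop. 3.9 (3.73) p.665, (4.42)–(4.43) p.675, Prop. 3.8 (3.71) p.664; Balaban1987RG1, §1 p.263 and §5 p.298] -/
theorem u3Rung_kingModel_threeFactor_torus (hd : 1 ≤ d) (L : ℕ) [NeZero L] (hLp : Odd L ∧ 1 < L) {a m2 : ℝ}
    (ha : 0 < a) (hm : 0 < m2) {γ : ℝ} (hγ0 : 0 ≤ γ) (hγ1 : γ ≤ 1) :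
    ∃ κ C₅ : ℝ, 0 < κ ∧ 0 ≤ C₅ ∧
      ∀ (n : ℕ) (_hn : 1 ≤ n) (M : ℕ → Fin d → ℕ) [∀ j μ, NeZero (M j μ)]
        (_hM : ∀ j, ∃ mm : ℕ, ∀ μ, L * M j μ = 2 * L ^ mm)
        (C : Carriers) (_hsc : ∀ X, 1 ≤ C.scale X)
        (xA yA : (X : C.Dom) → Tor (fine (L ^ C.scale X) (fine L (M (C.scale X)))))
        (xB yB : (X : C.Dom) → Tor (fine (L ^ n * L ^ C.scale X) (fine L (M (C.scale X)))))
        (_hx : ∀ X μ, (xA X μ).val = (xB X μ).val / L ^ n)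
        (_hy : ∀ X μ, (yA X μ).val = (yB X μ).val / L ^ n)
        (_hd : ∀ X, C.d X ≤ tdistT (fine L (M (C.scale X)))
            (blockOf (L ^ C.scale X) (fine L (M (C.scale X))) (xA X))
            (blockOf (L ^ C.scale X) (fine L (M (C.scale X))) (yA X)))
        (EA : Functional C C.BgA) (EB : Functional C C.BgB)
        (_hEA : ∀ g U X, EA g U X =
          (fun z => minimiser (L ^ C.scale X) (fine L (M (C.scale X))) (aK a L (C.scale X))
              (((L ^ C.scale X : ℕ) : ℝ) ^ 2) m2 (Pi.single z 1) (xA X))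
            ⬝ᵥ ((effLaplacian (L ^ C.scale X) (fine L (M (C.scale X))) (aK a L (C.scale X))
                    (((L ^ C.scale X : ℕ) : ℝ) ^ 2) m2
                  + (a * ((L : ℝ) ^ 2)⁻¹) • blockProj L (M (C.scale X)))⁻¹
                *ᵥ fun w => minimiser (L ^ C.scale X) (fine L (M (C.scale X))) (aK a L (C.scale X))
                    (((L ^ C.scale X : ℕ) : ℝ) ^ 2) m2 (Pi.single w 1) (yA X)))
        (_hEB : ∀ g U X, EB g U X =
          (fun z => minimiser (L ^ n * L ^ C.scale X) (fine L (M (C.scale X))) (aK a L (C.scale X + n))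
              (((L ^ n * L ^ C.scale X : ℕ) : ℝ) ^ 2) m2 (Pi.single z 1) (xB X))
            ⬝ᵥ ((effLaplacian (L ^ n * L ^ C.scale X) (fine L (M (C.scale X))) (aK a L (C.scale X + n))
                    (((L ^ n * L ^ C.scale X : ℕ) : ℝ) ^ 2) m2
                  + (a * ((L : ℝ) ^ 2)⁻¹) • blockProj L (M (C.scale X)))⁻¹
                *ᵥ fun w => minimiser (L ^ n * L ^ C.scale X) (fine L (M (C.scale X))) (aK a L (C.scale X + n))
                    (((L ^ n * L ^ C.scale X : ℕ) : ℝ) ^ 2) m2 (Pi.single w 1) (yB X)))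
        (W : Set (ℕ → ℝ)) (γ' ω cr ρ : ℝ),
        N18At ⟨C, W, γ', κ, EA, fun _ => EB, (L : ℝ) ^ (-(γ / 2)), C₅, fun _ _ => 0, 0, ω, cr, ρ⟩ ∧
        N22At ⟨C, W, γ', κ, EA, fun _ => EB, (L : ℝ) ^ (-(γ / 2)), C₅, fun _ _ => 0, 0, ω, cr, ρ⟩ ∧
        LipBackground EA W κ (fun _ _ => 0) ∧
        (∀ (gT : ℕ → ℕ → ℝ) (q : ℕ), PolyLipGrowth (fun _ _ => 0) gT 0 q) ∧
        (∀ {gA gB : ℕ → ℝ}, gA ∈ W → gB ∈ W → ∀ (UA : C.BgA) (UB : C.BgB) (X : C.Dom),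
          |EA gA UA X - EB gB UB X| ≤
            (0 + 0 + C₅) * ((L : ℝ) ^ (-(γ / 2))) ^ C.scale X * Real.exp (-(κ * C.d X))) := by
  obtain ⟨κ, C₅, hκ, hC₅, H⟩ := ne5_kingModel_threeFactor_torus hd L hLp ha hm hγ0 hγ1
  refine ⟨κ, C₅, hκ, hC₅, ?_⟩
  intro n hn M _ hM C hsc xA yA xB yB hx hy hdd EA EB hEA hEB W γ' ω cr ρ
  have h5 : NE5 EA EB W κ ((L : ℝ) ^ (-(γ / 2))) C₅ := H n hn M hM C hsc xA yA xB yB hx hy hdd EA EB hEA hEB W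
  -- the model's functionals read neither the background nor the coupling sequence
  have hU : ∀ g U U' X, EA g U X = EA g U' X := fun g U U' X => by rw [hEA, hEA]
  have hg : ∀ g g' U X, EA g U X = EA g' U X := fun g g' U X => by rw [hEA, hEA]
  refine ⟨n18At_of_ne5 h5 γ' _ 0 ω cr ρ, n22At_of_couplingBlind hg W γ' κ _ _ C₅ ω cr ρ,
    lipBackground_zero_iff_unreadOn.2 fun g _ U U' X => hU g U U' X, fun gT q => polyLipGrowth_zero gT q, ?_⟩
  intro gA gB hgA hgB UA UB X
  exact u3Target_of_unread hU hg h5 hgA hgB UA UB X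

/-- **The same rung for the SUP-NORM reading** (King Prop. 3.8 (3.71) line 1, `N18KingModel.ne5_of_kingModel`, p411731:
run A reads `ℋ_k(x_A, b)`, run B reads `ℋ_{k+n}(x_B, b)`, `k = scale X ≥ 1`, ANY carriers): with `θ = L^{−γ}` and the
`k, n`-free constant `C₅(a, L, d, γ)` the bundle `⟨C, W, γ′, 0, EA, fun _ => EB, θ, C₅, 0, 0, ω, cr, ρ⟩` carries `N18At`,
`N22At`, the bracket (T) with the zero family, and node U3's target `(0 + 0 + C₅)·θ^{scale X}` at any two couplings and
backgrounds (`N18KingModelU3.u3Target_of_kingModel`) — decay exponent `0` (sup norm, before «combining with Theorem 3.3»).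
[cite: King1986, Prop. 3.8 (3.71) p.664, p.665] -/
theorem u3Rung_kingModel_prop38 (hd : 0 < d) {L : ℕ} [NeZero L] (hLodd : Odd L) (hL : 2 ≤ L) {n : ℕ} (hn : 1 ≤ n)
    (M : Fin d → ℕ) [∀ μ, NeZero (M μ)] {a m2 : ℝ} (ha : 0 < a) (hm : 0 < m2) {γ : ℝ} (hγ0 : 0 ≤ γ) (hγ1 : γ ≤ 1)
    (C : Carriers) (hscale : ∀ X, 1 ≤ C.scale X) (site : C.Dom → Tor M)
    (xA : (X : C.Dom) → Tor (fine (L ^ C.scale X) M)) (xB : (X : C.Dom) → Tor (fine (L ^ n * L ^ C.scale X) M))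
    (hx : ∀ X μ, (xA X μ).val = (xB X μ).val / L ^ n)
    (EA : Functional C C.BgA) (EB : Functional C C.BgB)
    (hEA : ∀ g U X, EA g U X =
      minimiser (L ^ C.scale X) M (aK a L (C.scale X)) (((L ^ C.scale X : ℕ) : ℝ) ^ 2) m2 (Pi.single (site X) 1) (xA X))
    (hEB : ∀ g U X, EB g U X =
      minimiser (L ^ n * L ^ C.scale X) M (aK a L (C.scale X + n)) (((L ^ n * L ^ C.scale X : ℕ) : ℝ) ^ 2) m2
        (Pi.single (site X) 1) (xB X))
    (W : Set (ℕ → ℝ)) (γ' ω cr ρ : ℝ) :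
    N18At ⟨C, W, γ', 0, EA, fun _ => EB, (L : ℝ) ^ (-γ),
        prop38RateConst a a (a * (2 * ((a * (1 - ((L : ℝ) ^ 2)⁻¹))⁻¹ + Real.pi ^ 2 / 48 + 1 / 3))) ((Real.pi ^ 2 / 4) ^ d) d γ
          + prop38PosConst a ((Real.pi ^ 2 / 4) ^ d) d γ, fun _ _ => 0, 0, ω, cr, ρ⟩ ∧
      N22At ⟨C, W, γ', 0, EA, fun _ => EB, (L : ℝ) ^ (-γ),
        prop38RateConst a a (a * (2 * ((a * (1 - ((L : ℝ) ^ 2)⁻¹))⁻¹ + Real.pi ^ 2 / 48 + 1 / 3))) ((Real.pi ^ 2 / 4) ^ d) d γ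
          + prop38PosConst a ((Real.pi ^ 2 / 4) ^ d) d γ, fun _ _ => 0, 0, ω, cr, ρ⟩ ∧
      LipBackground EA W 0 (fun _ _ => 0) ∧
      (∀ {gA gB : ℕ → ℝ}, gA ∈ W → gB ∈ W → ∀ (UA : C.BgA) (UB : C.BgB) (X : C.Dom),
        |EA gA UA X - EB gB UB X| ≤
          (0 + 0 + (prop38RateConst a a (a * (2 * ((a * (1 - ((L : ℝ) ^ 2)⁻¹))⁻¹ + Real.pi ^ 2 / 48 + 1 / 3)))
              ((Real.pi ^ 2 / 4) ^ d) d γ + prop38PosConst a ((Real.pi ^ 2 / 4) ^ d) d γ))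
            * ((L : ℝ) ^ (-γ)) ^ C.scale X * Real.exp (-(0 * C.d X))) := by
  have h5 := ne5_of_kingModel hd hLodd hL hn M ha hm hγ0 hγ1 C hscale site xA xB hx EA EB hEA hEB W
  have hU : ∀ g U U' X, EA g U X = EA g U' X := fun g U U' X => by rw [hEA, hEA]
  have hg : ∀ g g' U X, EA g U X = EA g' U X := fun g g' U X => by rw [hEA, hEA]
  exact ⟨n18At_of_ne5 h5 γ' _ 0 ω cr ρ, n22At_of_couplingBlind hg W γ' 0 _ _ _ ω cr ρ,
    lipBackground_zero_iff_unreadOn.2 fun g _ U U' X => hU g U U' X,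
    fun hgA hgB UA UB X => u3Target_of_unread hU hg h5 hgA hgB UA UB X⟩

/-! ## §3 The model on the END's own carriers `torusCarriers N W` ∕ read-out `reFunctional N W` -/

section EndCarriers

variable {L' : ℕ} [NeZero L']

open Classical in
/-- **A REAL two-run family on the torus domains, read through `reFunctional`, is `NE5` at the END's carriers.**  For real
families `K_A`, `K_B` on `Σ j, 𝐃_j` with `|K_A X − K_B X| ≤ C₅·θ^{j}·e^{−κ′·d_j(X)}` (`C₅ ≥ 0`, `θ ≥ 0`) and ANY torus
family `W j : TwoTorusStep 4 L′ (N j)`, the coupling- and background-blind complex families `E_A j X φ = K_A ⟨j, X⟩`,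
`E_B j X φ = K_B ⟨j, X⟩` satisfy `NE5 (torusCarriers N W) (reFunctional N W E_A) (reFunctional N W E_B) W′ κ′ θ C₅` for every
window — the carriers and read-out on which `TwoRunTorusNE5Final8.ne5_end_final_all8` concludes (off the space both
read-outs vanish). [cite: Balaban1987RG1, (0.24)-(0.25) p.257] -/
theorem ne5_reFunctional_of_real (N : ℕ → ℕ) [∀ j, NeZero (N j)] (W : (j : ℕ) → TwoTorusStep 4 L' (N j))
    (KA KB : (Σ j : ℕ, TDom 4 (N j)) → ℝ) {κ' θ C₅ : ℝ} (hC₅ : 0 ≤ C₅) (hθ : 0 ≤ θ)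
    (hK : ∀ X : Σ j : ℕ, TDom 4 (N j), |KA X - KB X| ≤ C₅ * θ ^ X.1 * Real.exp (-(κ' * (tsys 4 (N X.1)).dj X.2)))
    (W' : Set (ℕ → ℝ)) :
    NE5 (C := torusCarriers N W) (reFunctional N W fun j X _ => ((KA ⟨j, X⟩ : ℝ) : ℂ))
      (reFunctional N W fun j X _ => ((KB ⟨j, X⟩ : ℝ) : ℂ)) W' κ' θ C₅ := by
  intro g _ U X
  obtain ⟨j, X⟩ := X
  show |reFunctional N W (fun j X _ => ((KA ⟨j, X⟩ : ℝ) : ℂ)) g (id U) ⟨j, X⟩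
      - reFunctional N W (fun j X _ => ((KB ⟨j, X⟩ : ℝ) : ℂ)) g U ⟨j, X⟩|
    ≤ C₅ * θ ^ j * Real.exp (-(κ' * (tsys 4 (N j)).dj X))
  by_cases hφ : U j ∈ (W j).sp2 X
  · simp only [reFunctional, id, hφ, if_true, Complex.ofReal_re]
    exact hK ⟨j, X⟩
  · simp only [reFunctional, id, hφ, if_false, sub_zero, abs_zero]
    positivity

/-- **KING'S MODEL ON THE END'S CARRIERS** (director-ym R134 row n18 s3: the transfer `N18KingModel*` → `TwoRunTorusNE5Final*`).
Let King's data be `d ≥ 1`, odd `L ≥ 2`, `n ≥ 1`, a unit torus `Π_μ ℤ∕M_μ`, `a > 0`, `m² > 0`, `0 ≤ γ ≤ 1`, and let the END's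
domains `⟨j, X⟩` (`X ∈ 𝐃_j` of the torus with `N j` cubes per direction) read a unit site `b⟨j,X⟩`, run A's fine point
`x_A⟨j,X⟩` on King's level `j + 1` (`L^{j+1}` points per unit side; King's levels start at 1, (2.13)) UNDER run B's
`x_B⟨j,X⟩` (`L^nL^{j+1}` points).  Then for EVERY torus family `W j : TwoTorusStep 4 L′ (N j)` and every window `W′`, the
read-outs of King's Prop-3.8 kernels `E_A j X φ = ℋ_{j+1}(x_A, b)`, `E_B j X φ = ℋ_{j+1+n}(x_B, b)` satisfy
`NE5 (torusCarriers N W) (reFunctional N W E_A) (reFunctional N W E_B) W′ 0 (L^{−γ}) C₅(a, L, d, γ)` — `θ = L^{−γ} < 1` iff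
`γ > 0`, ONE constant for all scales ∕ volumes ∕ masses; `κ′ = 0` (King's two-point graphs carry no decay in `d_j(X)`;
see the module docstring).  `N18KingModel.ne5_of_kingModel` on the shifted-scale carriers, then `θ^{j+1} ≤ θ^j`, then
`ne5_reFunctional_of_real`. [cite: King1986, Prop. 3.8 (3.71) p.664, p.665; Balaban1987RG1, (0.24)-(0.25) p.257, Thm 1 p.259] -/
theorem ne5_kingModel_endCarriers (hd : 0 < d) {L : ℕ} [NeZero L] (hLodd : Odd L) (hL : 2 ≤ L) {n : ℕ} (hn : 1 ≤ n)
    (M : Fin d → ℕ) [∀ μ, NeZero (M μ)] {a m2 : ℝ} (ha : 0 < a) (hm : 0 < m2) {γ : ℝ} (hγ0 : 0 ≤ γ) (hγ1 : γ ≤ 1)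
    (N : ℕ → ℕ) [∀ j, NeZero (N j)] (W : (j : ℕ) → TwoTorusStep 4 L' (N j))
    (site : (Σ j : ℕ, TDom 4 (N j)) → Tor M)
    (xA : (X : Σ j : ℕ, TDom 4 (N j)) → Tor (fine (L ^ (X.1 + 1)) M))
    (xB : (X : Σ j : ℕ, TDom 4 (N j)) → Tor (fine (L ^ n * L ^ (X.1 + 1)) M))
    (hx : ∀ X μ, (xA X μ).val = (xB X μ).val / L ^ n) (W' : Set (ℕ → ℝ)) :
    NE5 (C := torusCarriers N W)
      (reFunctional N W fun j X _ =>
        ((minimiser (L ^ (j + 1)) M (aK a L (j + 1)) (((L ^ (j + 1) : ℕ) : ℝ) ^ 2) m2 (Pi.single (site ⟨j, X⟩) 1)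
          (xA ⟨j, X⟩) : ℝ) : ℂ))
      (reFunctional N W fun j X _ =>
        ((minimiser (L ^ n * L ^ (j + 1)) M (aK a L (j + 1 + n)) (((L ^ n * L ^ (j + 1) : ℕ) : ℝ) ^ 2) m2
          (Pi.single (site ⟨j, X⟩) 1) (xB ⟨j, X⟩) : ℝ) : ℂ))
      W' 0 ((L : ℝ) ^ (-γ))
      (prop38RateConst a a (a * (2 * ((a * (1 - ((L : ℝ) ^ 2)⁻¹))⁻¹ + Real.pi ^ 2 / 48 + 1 / 3))) ((Real.pi ^ 2 / 4) ^ d) d γ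
        + prop38PosConst a ((Real.pi ^ 2 / 4) ^ d) d γ) := by
  set θ : ℝ := (L : ℝ) ^ (-γ) with hθ_def
  set C₅ : ℝ := prop38RateConst a a (a * (2 * ((a * (1 - ((L : ℝ) ^ 2)⁻¹))⁻¹ + Real.pi ^ 2 / 48 + 1 / 3)))
      ((Real.pi ^ 2 / 4) ^ d) d γ + prop38PosConst a ((Real.pi ^ 2 / 4) ^ d) d γ with hC₅_def
  have hC₅ : 0 ≤ C₅ := prop38Const_unif_nonneg hd ha hL (by linarith)
  have hL1 : 1 ≤ L := by omega
  have hθ0 : 0 ≤ θ := (kingTheta_pos hL1 γ).le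
  have hθ1 : θ ≤ 1 := kingTheta_le_one hL1 hγ0
  -- King's Prop. 3.8 at the SHIFTED-scale carriers (scale `j + 1 ≥ 1`, tree length `0`, trivial backgrounds)
  have h5 := ne5_of_kingModel hd hLodd hL hn M ha hm hγ0 hγ1
    { Dom := Σ j : ℕ, TDom 4 (N j), scale := fun X => X.1 + 1, d := fun _ => 0, d_nonneg := fun _ => le_rfl,
      BgA := PUnit, BgB := PUnit, gauge := fun _ _ => 0, gauge_nonneg := fun _ _ => le_rfl, transport := id }
    (fun _ => Nat.succ_le_succ (Nat.zero_le _)) site xA xB hx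
    (fun _ _ X => minimiser (L ^ (X.1 + 1)) M (aK a L (X.1 + 1)) (((L ^ (X.1 + 1) : ℕ) : ℝ) ^ 2) m2
      (Pi.single (site X) 1) (xA X))
    (fun _ _ X => minimiser (L ^ n * L ^ (X.1 + 1)) M (aK a L (X.1 + 1 + n)) (((L ^ n * L ^ (X.1 + 1) : ℕ) : ℝ) ^ 2) m2
      (Pi.single (site X) 1) (xB X))
    (fun _ _ _ => rfl) (fun _ _ _ => rfl) Set.univ
  refine ne5_reFunctional_of_real N W
    (fun Y => minimiser (L ^ (Y.1 + 1)) M (aK a L (Y.1 + 1)) (((L ^ (Y.1 + 1) : ℕ) : ℝ) ^ 2) m2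
      (Pi.single (site Y) 1) (xA Y))
    (fun Y => minimiser (L ^ n * L ^ (Y.1 + 1)) M (aK a L (Y.1 + 1 + n)) (((L ^ n * L ^ (Y.1 + 1) : ℕ) : ℝ) ^ 2) m2
      (Pi.single (site Y) 1) (xB Y))
    hC₅ hθ0 (fun X => ?_) W'
  have hX := h5 (fun _ => 1) (Set.mem_univ _) PUnit.unit X
  -- `θ^{j+1} ≤ θ^j` and the tree length does not enter at `κ′ = 0`
  rw [zero_mul, neg_zero, Real.exp_zero, mul_one]
  rw [zero_mul, neg_zero, Real.exp_zero, mul_one] at hX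
  refine hX.trans (mul_le_mul_of_nonneg_left ?_ hC₅)
  calc θ ^ (X.1 + 1) = θ ^ X.1 * θ := pow_succ θ X.1
    _ ≤ θ ^ X.1 * 1 := mul_le_mul_of_nonneg_left hθ1 (pow_nonneg hθ0 _)
    _ = θ ^ X.1 := mul_one _

/-- **… AS `N18At` ON THE END's BUNDLE SHAPE.**  The bundle `⟨torusCarriers N W, W′, γ′, 0, reFunctional … E_A, fun _ =>
reFunctional … E_B, L^{−γ}, C₅(a, L, d, γ), Λ, C₉, ω, cr, ρ⟩` — the shape on which `N18AtByName.n18At_of_end8_shape` reads the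
END — carries `N18At` for King's kernels, for ANY remaining letters: the route's N18 decl is inhabited with a rate `< 1`
(`γ > 0`) on the carrier TYPE of record. [cite: King1986, Prop. 3.8 (3.71) p.664, p.665; Balaban1988RG2Cluster, (2.41) p.21] -/
theorem n18At_kingModel_endCarriers (hd : 0 < d) {L : ℕ} [NeZero L] (hLodd : Odd L) (hL : 2 ≤ L) {n : ℕ} (hn : 1 ≤ n)
    (M : Fin d → ℕ) [∀ μ, NeZero (M μ)] {a m2 : ℝ} (ha : 0 < a) (hm : 0 < m2) {γ : ℝ} (hγ0 : 0 ≤ γ) (hγ1 : γ ≤ 1)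
    (N : ℕ → ℕ) [∀ j, NeZero (N j)] (W : (j : ℕ) → TwoTorusStep 4 L' (N j))
    (site : (Σ j : ℕ, TDom 4 (N j)) → Tor M)
    (xA : (X : Σ j : ℕ, TDom 4 (N j)) → Tor (fine (L ^ (X.1 + 1)) M))
    (xB : (X : Σ j : ℕ, TDom 4 (N j)) → Tor (fine (L ^ n * L ^ (X.1 + 1)) M))
    (hx : ∀ X μ, (xA X μ).val = (xB X μ).val / L ^ n) (W' : Set (ℕ → ℝ)) (γ' : ℝ) (Λ : ℕ → ℕ → ℝ)
    (C₉ ω cr ρ : ℝ) :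
    N18At ⟨torusCarriers N W, W', γ', 0,
      reFunctional N W fun j X _ =>
        ((minimiser (L ^ (j + 1)) M (aK a L (j + 1)) (((L ^ (j + 1) : ℕ) : ℝ) ^ 2) m2 (Pi.single (site ⟨j, X⟩) 1)
          (xA ⟨j, X⟩) : ℝ) : ℂ),
      fun _ => reFunctional N W fun j X _ =>
        ((minimiser (L ^ n * L ^ (j + 1)) M (aK a L (j + 1 + n)) (((L ^ n * L ^ (j + 1) : ℕ) : ℝ) ^ 2) m2
          (Pi.single (site ⟨j, X⟩) 1) (xB ⟨j, X⟩) : ℝ) : ℂ),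
      (L : ℝ) ^ (-γ),
      prop38RateConst a a (a * (2 * ((a * (1 - ((L : ℝ) ^ 2)⁻¹))⁻¹ + Real.pi ^ 2 / 48 + 1 / 3))) ((Real.pi ^ 2 / 4) ^ d) d γ
        + prop38PosConst a ((Real.pi ^ 2 / 4) ^ d) d γ,
      Λ, C₉, ω, cr, ρ⟩ :=
  fun _ _ _ => ne5_kingModel_endCarriers hd hLodd hL hn M ha hm hγ0 hγ1 N W site xA xB hx W'

end EndCarriers

end Summit.QuantumFields.YangMills.BalabanUVNodes.N18KingModelU3Rung

end
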